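import Summits.QuantumFields.YangMills.Theorems.BalabanUVNodesN22W1PrintedBoxBlock
import Literature.MathematicalPhysics.QuantumFieldTheory.Balaban1983to89.Node00.HistoryTermDatum214LocalGrowth

/-!
# BalabanUVNodes ∕ node N22 = NE9 — THE PRINTED BOX BLOCK AT THE (2.14) TERM DATUM: node00-def-W1's `UnscaledBoxLaws` INHABITED at print's boxes, the
# J17-D box binders at the datum's row-bond types under node00-def-B13's `|Pl| = |P|`, and the tail letters `T TP Mv r₁` chosen ONCE on the coupling window
# `]0, γ]` at print's forced threshold `rP = Rb = ε₁ ∕ s₀`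

Cell `pub-ymgap`, HUMAN RULING D-0062 (Track A) ∕ D-0149 (width seats), seat `pub-ymgap-dag-n22-w1` (WIDTH SEAT 1 of 3 on node n22), generation 0, file 2.
THEOREMS ONLY (0 `def`, 0 `sorry`); imports this seat's file 1 `…N22W1PrintedBoxBlock` (the abstract block: `chi_mul_chic_le_exp_222(_print)`, `chi_mul_chic_le_one`,
`chi_mul_chic_eq_one_of_dotProduct_lt`, `chi_ne_zero_support_le`, `chi_neg ∕ chic_neg ∕ measurable_chi ∕ measurable_chic ∕ chi_smul_nonneg …`, `boxTail_le_uniform`,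
`surplusTail_le_uniform`) and node00-def-W1's W1-12 `Node00/HistoryTermDatum214LocalGrowth` (`TermDatum214.UnscaledBoxLaws`; through it W1-7 `TermDatum214`, W1-11
`UnscaledChi`); restates nothing.  `--kind proof --supports stmt-QuantumFields-20544 --as helper` (K3⁷ `SpineGivenEndpointR13SepCoPH`).  dag-n22-c g10's lane word
(pub-ymgap INBOX 2026-08-27T22:58Z): «w1 take the box block» (fields `hχ0 … hPa1` of J17-D `SliceInputsL2U`).

WHAT.
* §1 THE SHARP SMALL-WINDOW TAIL LETTER: `exp_neg_div_div_mono` (`x ↦ e^{−c∕x}∕x` increases on `]0, c]`), `exp_neg_div_sq_le_window` ∕ `boxTail_le_window` (for `s₀ ≤ γ`,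
  `γ² ≤ ½κε²`: `e^{−½κ(ε∕s₀)²} ≤ T(γ)·s₀²`, `T(γ) := e^{−½κε²∕γ²}∕γ²` — the letter of [I] p. 268 «the expression under the exponential … vanishes at g_k = 0»).
* §2 `threshold_sq_window_le` (hr₁ at `r₁ := ε∕γ` on the whole window), `surplus_le_window` (hPa from hPa1).
* §3 ★ `exists_tailLetters_window` — ONE `(T, TP, Mv, r₁)` meeting the record's `hRb ∕ hTP ∕ hMvT ∕ hMvP ∕ hr₁` shapes at `Rb = rP = ε∕s₀` for EVERY `s₀ ∈ ]0, γ]`.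
* §4 AT THE DATUM `𝔇 : TermDatum214 c P 𝔸 M k L` with row-bond maps `Y0l Pl Z t ⊆ (𝔇.𝒦 Z t).Λ` (node00-def-B13's `ResidB13K.Y0l ∕ Pl` shapes) and print's boxes in hypothesis
  form `hχu : ∀ Z t A, χu Z t A = Π_{b∈Y0l Z t} χ(|A b| < ε₁)`, `hχcu : … Π_{b∈Pl Z t} χ(ε₁ ≤ |A b|)`: ★ `unscaledBoxLaws_of_printedBoxes` (W1-12's law record INHABITED —
  the tree had only the constant boxes `unscaledBoxLaws_const`), and the J17-D binders at the datum's types: `h222_atDatum` (under `hPcard : |Pl Z t| = |t.2|`),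
  `hχ1_atDatum`, `hboxR_atDatum` (`t.2 = ∅`, `Rb·s₀ ≤ ε₁`), `hbox_atDatum` (`S₀ := ↑(Y0l Z t)`), `hqP_atDatum`; and the junction with W1-11's LAW:
  `unscaledFieldLawOn_of_printedBoxes` (if the datum's `chiY₀ ∕ chicP` at real `s` are print's products at threshold `ε₁∕s` — node00-def-B13's display — the law's
  χ-clauses hold at the s-free boxes; its `𝐕 = s⁻²𝒲 + 𝒪` clause displayed).

TREE TWINS (disclosure, found after file 1 landed).  lit-balaban r10's `Literature/…/B13Lemma3TorusBinders` §1 already carries (2.22) in product form over an abstract bond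
type — `prod_indicator_le_exp_222`, `h222_of_charFns` (the `h222` letter of N10's capstone, boxes read at `B` with threshold `r`), `sum_sq_le_dotProduct` (statement
identical to file 1's lemma of the same short name, other namespace) —; file 1's `prodLarge_le_exp_sum ∕ chi_mul_chic_le_exp_222 ∕ sum_sq_le_dotProduct` are the same
mathematics read at the DILATED field `s₀ • B` with the threshold letter `rP·s₀ ≤ ε` and `n ≤ |P|` (J17-D's shapes); consumers needing the s-free form should cite the
Literature twins.  Nothing of record is re-declared (distinct namespaces; no Theses ∕ item statement involved).

HONEST FRAMING — what this is NOT.  Real-variable bookkeeping + instantiation of file 1 at the datum's types; count-neutral; NOT a discharge of N22 (typed 28∕28 · discharged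
5∕27 UNCHANGED; the chair's count line is the only count).  NOTHING of Bałaban's construction asserted: the datum `𝔇`, its row-bond maps `Y0l ∕ Pl` with `|Pl| = |P|`, the
threshold `ε₁` and the identification of `𝔇.chiY₀ ∕ chicP` with print's boxes (W1-11's law) remain the definers' pins; whether the knit's aperture ∕ volume numerals are met
jointly with §3's letters at the datum of record is dag-n22-w2's window lane and NODE A's letters, not claimed here.  One finite four-torus programme at fixed ε — R4 closes
the conditional rung `BalabanLadder.UV` only; NOT continuum, NOT OS, NOT a mass gap, NOT Clay.  0 `sorry`, standard axioms.

References (TYPES ∕ loci only): [I] = [Balaban1987RG1] (2.9) p. 266, (2.12)–(2.13) p. 268; [II] = [Balaban1988RG2Cluster] (2.2)–(2.3) p. 12, (2.14) p. 15, (2.22) p. 16.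
-/

namespace Summit.QuantumFields.YangMills.BalabanUVNodes.N22PrintedBoxBlock

open Set Matrix
open scoped BigOperators

/-! ## §1 The sharp small-window tail letter (monotone branch of `x ↦ e^{−c∕x}∕x`) -/

/-- On `0 < x ≤ y ≤ c` the function `x ↦ e^{−c∕x}∕x` is increasing: `e^{−c∕x}∕x ≤ e^{−c∕y}∕y` (from `1 + u ≤ eᵘ` at `u = c∕x − c∕y`). [folklore] -/
theorem exp_neg_div_div_mono {c x y : ℝ} (hx : 0 < x) (hxy : x ≤ y) (hyc : y ≤ c) :
    Real.exp (-(c / x)) / x ≤ Real.exp (-(c / y)) / y := by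
  have hy : 0 < y := hx.trans_le hxy
  have hratio : y / x ≤ Real.exp (c / x - c / y) := by
    have hlin : y / x ≤ 1 + (c / x - c / y) := by
      rw [div_le_iff₀ hx]
      have h1 : (1 + (c / x - c / y)) * x = x + c - c * x / y := by
        field_simp
        ring
      rw [h1]
      have h2 : (y - x) * (c - y) / y ≥ 0 := div_nonneg (mul_nonneg (by linarith) (by linarith)) hy.le
      have h3 : x + c - c * x / y - y = (y - x) * (c - y) / y := by
        field_simp
        ring
      linarith [h2, h3]
    exact hlin.trans (by linarith [Real.add_one_le_exp (c / x - c / y)])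
  rw [div_le_div_iff₀ hx hy]
  have hexp : Real.exp (-(c / y)) = Real.exp (-(c / x)) * Real.exp (c / x - c / y) := by
    rw [← Real.exp_add]
    ring_nf
  rw [hexp, mul_assoc]
  refine mul_le_mul_of_nonneg_left ?_ (Real.exp_pos _).le
  calc y = y / x * x := by field_simp
    _ ≤ Real.exp (c / x - c / y) * x := mul_le_mul_of_nonneg_right hratio hx.le

/-- **THE SHARP SMALL-WINDOW TAIL LETTER**: for a window radius with `γ² ≤ c`, every base point `0 < s₀ ≤ γ` has `e^{−c∕s₀²} ≤ (e^{−c∕γ²}∕γ²)·s₀²` — the letter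
`T(γ) := e^{−c∕γ²}∕γ²` tends to `0` faster than any power as `γ → 0`. [cite: Balaban1987RG1, (2.13) p.268] -/
theorem exp_neg_div_sq_le_window {c γ s₀ : ℝ} (hs : 0 < s₀) (hsγ : s₀ ≤ γ) (hγc : γ ^ 2 ≤ c) :
    Real.exp (-(c / s₀ ^ 2)) ≤ Real.exp (-(c / γ ^ 2)) / γ ^ 2 * s₀ ^ 2 := by
  have hs2 : 0 < s₀ ^ 2 := by positivity
  have hmono := exp_neg_div_div_mono hs2 (pow_le_pow_left₀ hs.le hsγ 2) hγc
  calc Real.exp (-(c / s₀ ^ 2)) = Real.exp (-(c / s₀ ^ 2)) / s₀ ^ 2 * s₀ ^ 2 := by field_simp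
    _ ≤ Real.exp (-(c / γ ^ 2)) / γ ^ 2 * s₀ ^ 2 := mul_le_mul_of_nonneg_right hmono hs2.le

/-- `hRb` with the SHARP window letter at print's box radius `Rb = ε∕s₀`: window `γ² ≤ ½κε²`, every `0 < s₀ ≤ γ`: `e^{−½κ(ε∕s₀)²} ≤ T(γ)·s₀²`,
`T(γ) := e^{−½κε²∕γ²}∕γ²`. [cite: Balaban1987RG1, (2.9) p.266 and (2.13) p.268] -/
theorem boxTail_le_window {κ ε γ s₀ : ℝ} (hs : 0 < s₀) (hsγ : s₀ ≤ γ) (hγ : γ ^ 2 ≤ κ / 2 * ε ^ 2) :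
    Real.exp (-(κ / 2 * (ε / s₀) ^ 2)) ≤ Real.exp (-(κ / 2 * ε ^ 2 / γ ^ 2)) / γ ^ 2 * s₀ ^ 2 := by
  have hre : κ / 2 * (ε / s₀) ^ 2 = κ / 2 * ε ^ 2 / s₀ ^ 2 := by rw [div_pow]; ring
  rw [hre]
  exact exp_neg_div_sq_le_window hs hsγ hγ

/-! ## §2 Window-uniform threshold comparisons at `rP = ε ∕ s₀` -/

/-- On the window `s₀ ≤ γ` print's threshold dominates the window's: `(ε∕γ)² ≤ (ε∕s₀)²` (`hr₁` with `r₁ := ε∕γ`). [cite: Balaban1988RG2Cluster, (2.3) p.12] -/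
theorem threshold_sq_window_le {ε γ s₀ : ℝ} (hε : 0 ≤ ε) (hs : 0 < s₀) (hsγ : s₀ ≤ γ) : (ε / γ) ^ 2 ≤ (ε / s₀) ^ 2 :=
  pow_le_pow_left₀ (div_nonneg hε (hs.trans_le hsγ).le) (div_le_div_of_nonneg_left hε hs hsγ) 2

/-- `hPa` uniformly on the window: `a ≤ γ₂(ε∕γ)²` gives `a ≤ γ₂·rP²` at `rP = ε∕s₀` for every `s₀ ≤ γ` (`γ₂ ≥ 0`). [cite: Balaban1988RG2Cluster, (2.22) p.16] -/
theorem surplus_le_window {a γ₂ ε γ s₀ : ℝ} (hγ₂ : 0 ≤ γ₂) (hε : 0 ≤ ε) (hs : 0 < s₀) (hsγ : s₀ ≤ γ) (ha : a ≤ γ₂ * (ε / γ) ^ 2) :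
    a ≤ γ₂ * (ε / s₀) ^ 2 :=
  ha.trans (mul_le_mul_of_nonneg_left (threshold_sq_window_le hε hs hsγ) hγ₂)

/-! ## §3 ONE set of tail letters for the whole window, in the record's field shapes -/

/-- ★ **THE BOX BLOCK'S TAIL LETTERS ARE WINDOW-UNIFORM AT PRINT'S THRESHOLDS** (`κ, γ₂, ε > 0`, any window radius `γ > 0`): there are letters `T, TP > 0`, `Mv > 1`,
`r₁ ≥ 0` with `1 + T ≤ Mv`, `TP ≤ Mv`, such that for EVERY base point `s₀ ∈ ]0, γ]`, at `Rb = rP := ε∕s₀`: `e^{−½κRb²} ≤ T·s₀²` (hRb), `e^{−½γ₂(rP² − r₁²)} ≤ TP·s₀²`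
(hTP), `r₁² ≤ rP²` (hr₁) — witnesses `r₁ := ε∕γ`, `T := (e·½κε²)⁻¹`, `TP := e^{½γ₂r₁²}·(e·½γ₂ε²)⁻¹`, `Mv := 1 + T + TP` (file 1 §5); `hPa ∕ hPa1` then read `a ≤ γ₂r₁²`
(`surplus_le_window`). [cite: Balaban1987RG1, (2.13) p.268; Balaban1988RG2Cluster, (2.22) p.16] -/
theorem exists_tailLetters_window {κ γ₂ ε γ : ℝ} (hκ : 0 < κ) (hγ₂ : 0 < γ₂) (hε : 0 < ε) (hγ : 0 < γ) :
    ∃ T TP Mv r₁ : ℝ, 0 < T ∧ 0 < TP ∧ 0 ≤ r₁ ∧ 1 + T ≤ Mv ∧ TP ≤ Mv ∧ 1 < Mv ∧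
      ∀ s₀ ∈ Ioc (0 : ℝ) γ,
        Real.exp (-(κ / 2 * (ε / s₀) ^ 2)) ≤ T * s₀ ^ 2 ∧
        Real.exp (-(γ₂ / 2 * ((ε / s₀) ^ 2 - r₁ ^ 2))) ≤ TP * s₀ ^ 2 ∧
        r₁ ^ 2 ≤ (ε / s₀) ^ 2 := by
  refine ⟨(Real.exp 1 * (κ / 2 * ε ^ 2))⁻¹, Real.exp (γ₂ / 2 * (ε / γ) ^ 2) * (Real.exp 1 * (γ₂ / 2 * ε ^ 2))⁻¹,
    1 + (Real.exp 1 * (κ / 2 * ε ^ 2))⁻¹ + Real.exp (γ₂ / 2 * (ε / γ) ^ 2) * (Real.exp 1 * (γ₂ / 2 * ε ^ 2))⁻¹, ε / γ,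
    by positivity, by positivity, by positivity, ?_, ?_, ?_, fun s₀ hs₀ => ⟨?_, ?_, ?_⟩⟩
  · have : 0 ≤ Real.exp (γ₂ / 2 * (ε / γ) ^ 2) * (Real.exp 1 * (γ₂ / 2 * ε ^ 2))⁻¹ := by positivity
    linarith
  · have : 0 ≤ (Real.exp 1 * (κ / 2 * ε ^ 2))⁻¹ := by positivity
    linarith
  · have h1 : 0 < (Real.exp 1 * (κ / 2 * ε ^ 2))⁻¹ := by positivity
    have h2 : 0 ≤ Real.exp (γ₂ / 2 * (ε / γ) ^ 2) * (Real.exp 1 * (γ₂ / 2 * ε ^ 2))⁻¹ := by positivity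
    linarith
  · exact boxTail_le_uniform hκ hε hs₀.1
  · exact surplusTail_le_uniform (ε / γ) hγ₂ hε hs₀.1
  · exact threshold_sq_window_le hε.le hs₀.1 hs₀.2

/-! ## §4 At the (2.14) term datum: W1-12's `UnscaledBoxLaws` inhabited at print's boxes and the J17-D binders at the datum's row-bond types -/

section AtDatum

open Literature.MathematicalPhysics.QuantumFieldTheory.Balaban1983to89
open Literature.MathematicalPhysics.QuantumFieldTheory.Balaban1983to89.Node00
open Literature.MathematicalPhysics.QuantumFieldTheory.Balaban1983to89.TreeLengthTorus (TDom)
open Literature.MathematicalPhysics.QuantumFieldTheory.Balaban1983to89.Node00.Sect2 (domSys domCount CPair)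
open Literature.MathematicalPhysics.QuantumFieldTheory.Balaban1983to89.Node00.W1

variable {c : B13.Consts} {P : Params} {𝔸 : Type*} {M k L : ℕ} [NeZero L] (𝔇 : TermDatum214 c P 𝔸 M k L)
  (χu χcu : 𝔇.UnscaledChi)
  (Y0l Pl : (Z : (domSys P M (k + 1)).Dom) → (t : TermLabel P M k L) → Finset (𝔇.𝒦 Z t).Λ) (ε₁ : ℝ)

/-- ★ **node00-def-W1's `UnscaledBoxLaws` INHABITED AT PRINT'S BOXES** (the tree's only inhabitant so far was the constant boxes `unscaledBoxLaws_const`): with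
`χᵘ(A) = Π_{b∈Y0l} χ(|A(b)| < ε₁)`, `χᶜᵘ(A) = Π_{b∈Pl} χ(ε₁ ≤ |A(b)|)` on the term's row bonds, the boxes are nonnegative, even and measurable at EVERY term slice.
[cite: Balaban1987RG1, (2.9) p.266; Balaban1988RG2Cluster, (2.3) p.12 and (2.14) p.15] -/
theorem unscaledBoxLaws_of_printedBoxes
    (hχu : ∀ Z t A, χu Z t A = ∏ b ∈ Y0l Z t, (if |A b| < ε₁ then (1 : ℝ) else 0))
    (hχcu : ∀ Z t A, χcu Z t A = ∏ b ∈ Pl Z t, (if ε₁ ≤ |A b| then (1 : ℝ) else 0))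
    (Z : (domSys P M (k + 1)).Dom) (t : TermLabel P M k L) : 𝔇.UnscaledBoxLaws χu χcu Z t where
  hχ0 A := by rw [hχu]; exact prodBox_nonneg _ _ _
  hχc0 A := by rw [hχcu]; exact prodLarge_nonneg _ _ _
  hχe A := chi_neg (χu Z t) (Y0l Z t) ε₁ (hχu Z t) A
  hχce A := chic_neg (χcu Z t) (Pl Z t) ε₁ (hχcu Z t) A
  hχm := measurable_chi (χu Z t) (Y0l Z t) ε₁ (hχu Z t)
  hχcm := measurable_chic (χcu Z t) (Pl Z t) ε₁ (hχcu Z t)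

/-- **`h222` AT THE DATUM** under node00-def-B13's located pin `|Pl Z t| = |P(t)|`: (2.22) at the base point `s₀ > 0` with print's threshold `rP = ε₁∕s₀`, `qP B := Σ_{b∈Pl} B(b)²`,
in J17-D's field shape. [cite: Balaban1988RG2Cluster, (2.22) p.16 and (2.3) p.12] -/
theorem h222_atDatum (hχu : ∀ Z t A, χu Z t A = ∏ b ∈ Y0l Z t, (if |A b| < ε₁ then (1 : ℝ) else 0))
    (hχcu : ∀ Z t A, χcu Z t A = ∏ b ∈ Pl Z t, (if ε₁ ≤ |A b| then (1 : ℝ) else 0))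
    (Z : (domSys P M (k + 1)).Dom) (t : TermLabel P M k L) (hPcard : (Pl Z t).card = t.2.card)
    {s₀ γ₂ : ℝ} (hs : 0 < s₀) (hγ : 0 ≤ γ₂) (hε : 0 ≤ ε₁) (B : (𝔇.𝒦 Z t).Λ → ℝ) :
    χu Z t (s₀ • B) * χcu Z t (s₀ • B) ≤ Real.exp (-(γ₂ / 2 * (ε₁ / s₀) ^ 2 * (t.2.card : ℕ)) + γ₂ / 2 * ∑ b ∈ Pl Z t, B b ^ 2) := by
  rw [← hPcard]
  exact chi_mul_chic_le_exp_222_print (χu Z t) (χcu Z t) (Y0l Z t) (Pl Z t) ε₁ (hχu Z t) (hχcu Z t) hs hγ hε B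

/-- **`hqP` AT THE DATUM**: `Σ_{b∈Pl} B(b)² ≤ ⟨B, B⟩` on the term's row bonds. [cite: Balaban1988RG2Cluster, (2.22) p.16] -/
theorem hqP_atDatum (Z : (domSys P M (k + 1)).Dom) (t : TermLabel P M k L) (B : (𝔇.𝒦 Z t).Λ → ℝ) :
    ∑ b ∈ Pl Z t, B b ^ 2 ≤ B ⬝ᵥ B :=
  sum_sq_le_dotProduct (Pl Z t) B

/-- **`hχ1` AT THE DATUM** (J17-D's guarded shape; true unconditionally). [cite: Balaban1987RG1, (2.9) p.266; Balaban1988RG2Cluster, (2.3) p.12] -/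
theorem hχ1_atDatum (hχu : ∀ Z t A, χu Z t A = ∏ b ∈ Y0l Z t, (if |A b| < ε₁ then (1 : ℝ) else 0))
    (hχcu : ∀ Z t A, χcu Z t A = ∏ b ∈ Pl Z t, (if ε₁ ≤ |A b| then (1 : ℝ) else 0))
    (Z : (domSys P M (k + 1)).Dom) (t : TermLabel P M k L) (s₀ : ℝ) :
    t.2 = ∅ → ∀ B : (𝔇.𝒦 Z t).Λ → ℝ, χu Z t (s₀ • B) * χcu Z t (s₀ • B) ≤ 1 :=
  fun _ B => chi_mul_chic_le_one (χu Z t) (χcu Z t) (Y0l Z t) (Pl Z t) ε₁ (hχu Z t) (hχcu Z t) s₀ B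

/-- ★ **`hboxR` AT THE DATUM — THE BOX LAW** on a small-field slice (`P(t) = ∅`, hence `Pl Z t = ∅` under `|Pl| = |P|`): inside `⟨B, B⟩ < Rb²` with `Rb·s₀ ≤ ε₁`
(print: `Rb = ε₁∕s₀`), `χᵘ(s₀·B)·χᶜᵘ(s₀·B) = 1`. [cite: Balaban1987RG1, (2.9) p.266; Balaban1988RG2Cluster, (2.3) p.12] -/
theorem hboxR_atDatum (hχu : ∀ Z t A, χu Z t A = ∏ b ∈ Y0l Z t, (if |A b| < ε₁ then (1 : ℝ) else 0))
    (hχcu : ∀ Z t A, χcu Z t A = ∏ b ∈ Pl Z t, (if ε₁ ≤ |A b| then (1 : ℝ) else 0))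
    (Z : (domSys P M (k + 1)).Dom) (t : TermLabel P M k L) (hPcard : (Pl Z t).card = t.2.card)
    {s₀ Rb : ℝ} (hs : 0 < s₀) (hRb : 0 ≤ Rb) (hRbs : Rb * s₀ ≤ ε₁) :
    t.2 = ∅ → ∀ B : (𝔇.𝒦 Z t).Λ → ℝ, B ⬝ᵥ B < Rb ^ 2 → χu Z t (s₀ • B) * χcu Z t (s₀ • B) = 1 := by
  intro hP B hB
  have hPl : Pl Z t = ∅ := by
    rw [← Finset.card_eq_zero, hPcard, hP, Finset.card_empty]
  exact chi_mul_chic_eq_one_of_dotProduct_lt (χu Z t) (χcu Z t) (Y0l Z t) (Pl Z t) ε₁ (hχu Z t) (hχcu Z t) hPl hs hRb hRbs B hB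

/-- **`hbox` AT THE DATUM — THE s-FREE BOX-SUPPORT LAW** with support `S₀ := ↑(Y0l Z t)` and any `ρ ≥ ε₁`: `χᵘ(A) ≠ 0 ⇒ |A(b)| ≤ ρ` on `S₀`.
[cite: Balaban1987RG1, (2.9) p.266] -/
theorem hbox_atDatum (hχu : ∀ Z t A, χu Z t A = ∏ b ∈ Y0l Z t, (if |A b| < ε₁ then (1 : ℝ) else 0))
    (Z : (domSys P M (k + 1)).Dom) (t : TermLabel P M k L) {ρ : ℝ} (hρ : ε₁ ≤ ρ) :
    ∀ A : (𝔇.𝒦 Z t).Λ → ℝ, χu Z t A ≠ 0 → ∀ b ∈ ((Y0l Z t : Finset (𝔇.𝒦 Z t).Λ) : Set (𝔇.𝒦 Z t).Λ), |A b| ≤ ρ :=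
  fun A hA => chi_ne_zero_support_le (χu Z t) (Y0l Z t) ε₁ (hχu Z t) hρ A hA

/-- **THE χ-CLAUSES OF node00-def-W1's UNSCALED-FIELD LAW AT PRINT'S BOXES**: if the datum's boxes at every real window coupling `s ∈ ]0, γ]` ARE print's products at the
scaled threshold `ε₁∕s` (node00-def-B13's display `rP = ε₁∕‖g‖`, [I] (2.12) «B = g_kB′»), then W1-11's `UnscaledFieldLawOn` holds with the s-FREE unscaled boxes
`χᵘ(A) = Π χ(|A(b)| < ε₁)`, `χᶜᵘ(A) = Π χ(ε₁ ≤ |A(b)|)` — its potential clause `𝐕 = s⁻²𝒲 + 𝒪` is DISPLAYED (`h𝒱`, the Wilson ∕ older-terms producers').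
[cite: Balaban1987RG1, (2.9) p.266 and (2.12)-(2.13) p.268; Balaban1988RG2Cluster, (2.3) p.12] -/
theorem unscaledFieldLawOn_of_printedBoxes (𝒲 : 𝔇.UnscaledWilson) (𝒪 : 𝔇.UnscaledOlder) {γ : ℝ}
    (hχu : ∀ Z t A, χu Z t A = ∏ b ∈ Y0l Z t, (if |A b| < ε₁ then (1 : ℝ) else 0))
    (hχcu : ∀ Z t A, χcu Z t A = ∏ b ∈ Pl Z t, (if ε₁ ≤ |A b| then (1 : ℝ) else 0))
    (hY : ∀ (Z : (domSys P M (k + 1)).Dom) (t : TermLabel P M k L), ∀ s ∈ Ioc (0 : ℝ) γ, ∀ B : (𝔇.𝒦 Z t).Λ → ℝ,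
      𝔇.chiY₀ Z t (s : ℂ) B = ∏ b ∈ Y0l Z t, (if |B b| < ε₁ / s then (1 : ℝ) else 0))
    (hPc : ∀ (Z : (domSys P M (k + 1)).Dom) (t : TermLabel P M k L), ∀ s ∈ Ioc (0 : ℝ) γ, ∀ B : (𝔇.𝒦 Z t).Λ → ℝ,
      𝔇.chicP Z t (s : ℂ) B = ∏ b ∈ Pl Z t, (if ε₁ / s ≤ |B b| then (1 : ℝ) else 0))
    (h𝒱 : ∀ (Z : (domSys P M (k + 1)).Dom) (t : TermLabel P M k L), ∀ s ∈ Ioc (0 : ℝ) γ,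
      ∀ (old : OlderTerms P 𝔸 M k) (φ : CPair P 𝔸) (Y : TDom P.d (L * domCount P M (k + 1))) (B : (𝔇.𝒦 Z t).Λ → ℝ),
        𝔇.𝒱 Z t (s : ℂ) old φ Y B = (((s : ℝ) : ℂ) ^ 2)⁻¹ * 𝒲 Z t φ Y (s • B) + 𝒪 Z t old φ Y (s • B)) :
    𝔇.UnscaledFieldLawOn χu χcu 𝒲 𝒪 γ :=
  fun Z t s hs =>
    ⟨fun B => by rw [hY Z t s hs B, chi_smul_eq_prod_threshold (χu Z t) (Y0l Z t) ε₁ (hχu Z t) hs.1 B],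
      fun B => by rw [hPc Z t s hs B, chic_smul_eq_prod_threshold (χcu Z t) (Pl Z t) ε₁ (hχcu Z t) hs.1 B], h𝒱 Z t s hs⟩

end AtDatum

end Summit.QuantumFields.YangMills.BalabanUVNodes.N22PrintedBoxBlock
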